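import Literature.NumberTheory.Transcendental.KZGroundingRelations
import Literature.NumberTheory.Transcendental.SemialgebraicAlgebraicPoints

/-!
# Planar volumes are sums of one-variable integrals over algebraic intervals (Rung 2, file D)

Solo programme `solo-KontsevichZagierPeriods-informed`, line "Rung 2 of the volume ladder from
Huber–Wüstholz" (`SoloInformedRungTwo.lean`), first reduction step (L1 of `paper/rung2-v2.md`):
for a representation `r = [K, 1]` with `K ⊆ ℝ²` compact `ℚ`-semialgebraic,

  `[K, 1] ≡ Σᵢ [(aᵢ, bᵢ), Lᵢ]`  modulo the Kontsevich–Zagier relations,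

where the `(aᵢ, bᵢ)` are bounded open intervals of `ℝ¹` with real algebraic end points and each
`Lᵢ` (a vertical fibre length of `K`) is continuous, `ℚ`-semialgebraic, non-negative and bounded on
its interval (`soloInformed_planarBands`). The proof cuts `K` along the cylinders over the cells of
a cylindrical decomposition of `ℝ¹` adapted to `K` (Basu–Pollack–Roy, Cor. 5.7, proved in the tree),
discards the null cells, and over each interval cell goes down the inner bands by Newton–Leibniz
(rules (1), (3) of [KZ 2001, §1.2]; first half of the tree's `KZ.of_sub_of_mem_relations_cell`).

References: M. Kontsevich, D. Zagier, *Periods* (2001), §1.2 [KontsevichZagier2001];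
S. Basu, R. Pollack, M.-F. Roy, *Algorithms in Real Algebraic Geometry* (2006), Cor. 5.7.
-/

noncomputable section

open MeasureTheory Set
open Literature.ModelTheory.ExponentialFields Literature.NumberTheory.Transcendental
open Literature.NumberTheory.Transcendental.KZ

namespace Summit.KontsevichZagierPeriods.KontsevichZagierPeriods.Theorems

/-! ## 1. Over one cell of positive measure: down to the base by Newton–Leibniz -/

/-- **Down the bands over one cell.** Let `S ⊆ ℝ^{m+1}` be `ℚ`-semialgebraic of finite volume and
`C ⊆ ℝ^m` a `ℚ`-semialgebraic cell of positive measure with `ℚ`-semialgebraic increasing sections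
`ξ` over which the vertical fibres of `S` are the graphs `j ∈ G` and the bands `j ∈ B`. Then all
these bands are inner and `[S ∩ (C × ℝ), 1] ≡ [C, L]` with `L = Σ_{j ∈ B} (ξ_j − ξ_{j-1})` the fibre
length: `[S ∩ (C × ℝ)] ≡ Σ_j [band_j] ≡ Σ_j [closed band_j] ≡ Σ_j [C, ξ_j − ξ_{j-1}] ≡ [C, L]` by
rules (1), (1), (3), (1) (Steps 1–3 of `KZ.of_sub_of_mem_relations_cell`).
[Kontsevich–Zagier 2001, §1.2, rules (1), (3)] -/
theorem soloInformed_cell_base {m l : ℕ} {S : Set (Fin (m + 1) → ℝ)} (hS : IsSemialgebraic ℚ S)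
    (hfin : volume S ≠ ⊤) {C : Set (Fin m → ℝ)} (hC : IsSemialgebraic ℚ C) (hC0 : volume C ≠ 0)
    (ξ : Fin l → (Fin m → ℝ) → ℝ) (hξ : ∀ i, IsSemialgebraicFunOn ℚ C (ξ i))
    (hmono : ∀ x ∈ C, StrictMono fun i => ξ i x) (G : Finset (Fin l)) (B : Finset (Fin (l + 1)))
    (hBsub : ∀ j ∈ B, bandOver C ξ j ⊆ S) (hBsa : ∀ j, IsSemialgebraic ℚ (bandOver C ξ j))
    (hfib : ∀ x ∈ C, {t : ℝ | (Fin.snoc x t : Fin (m + 1) → ℝ) ∈ S} = (⋃ j ∈ G, {ξ j x}) ∪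
      ⋃ j ∈ B, {t : ℝ | bandLower ξ j x < (t : EReal) ∧ (t : EReal) < bandUpper ξ j x})
    (r : IntegralRep (m + 1)) (hrd : r.domain = S ∩ {z | Fin.init z ∈ C})
    (hr1 : ∀ x ∈ r.domain, r.integrand x = 1) :
    ∃ bL : IntegralRep m, bL.domain = C ∧
      (∀ x, bL.integrand x = ∑ j ∈ B, ((bandUpper ξ j x).toReal - (bandLower ξ j x).toReal)) ∧
      (∀ j ∈ B, j ≠ 0 ∧ j ≠ Fin.last l) ∧ of r - of bL ∈ relations := by
  classical
  have hSm : MeasurableSet S := IsSemialgebraic.measurableSet_holds hS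
  have hCm : MeasurableSet C := IsSemialgebraic.measurableSet_holds hC
  -- all bands over `C` are inner
  have hinner : ∀ j ∈ B, j ≠ 0 ∧ j ≠ Fin.last l := fun j hj =>
    ne_zero_and_ne_last_of_bandOver_subset hSm hfin hCm hC0 ξ (hBsub j hj)
  -- Step 1: cut `S ∩ (C × ℝ)` into its open bands
  have hOb : ∀ j : {j // j ∈ B}, ∃ Ob : IntegralRep (m + 1),
      Ob.domain = bandOver C ξ j ∧ Ob.integrand = fun _ => 1 := fun j =>
    exists_oneRep (hBsa j) ((measure_mono (hBsub j j.2)).trans_lt hfin.lt_top).ne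
  choose Ob hObd hObi using hOb
  have e1 : of r - ∑ j ∈ B.attach, of (Ob j) ∈ relations := by
    refine of_sub_sum_of_mem_relations B.attach r Ob (fun j _ => ?_) (fun j _ x hx => ?_) ?_ ?_
    · rw [hObd, hrd, show bandOver C ξ j \ (S ∩ {z | Fin.init z ∈ C}) = ∅ from
        sdiff_eq_empty.mpr fun z hz => ⟨hBsub j j.2 hz, (mem_bandOver_iff.1 hz).1⟩, measure_empty]
    · rw [hObi, hr1 x hx.2]
    · have hsub : r.domain \ ⋃ j ∈ B.attach, (Ob j).domain ⊆
          ⋃ j ∈ G, {z : Fin (m + 1) → ℝ | Fin.init z ∈ C ∧ z (Fin.last m) = ξ j (Fin.init z)} := by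
        intro z hz
        rw [hrd] at hz
        obtain ⟨⟨hzS, hzC⟩, hzU⟩ := hz
        have hzC : Fin.init z ∈ C := hzC
        have ht : z (Fin.last m) ∈ {t : ℝ | (Fin.snoc (Fin.init z) t : Fin (m + 1) → ℝ) ∈ S} := by
          show Fin.snoc (Fin.init z) (z (Fin.last m)) ∈ S
          rw [Fin.snoc_init_self]; exact hzS
        rw [hfib _ hzC] at ht
        rcases ht with ht | ht
        · simp only [mem_iUnion, mem_singleton_iff, exists_prop] at ht
          obtain ⟨j, hj, hjt⟩ := ht
          exact mem_iUnion₂.2 ⟨j, hj, hzC, hjt⟩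
        · simp only [mem_iUnion, mem_setOf_eq, exists_prop] at ht
          obtain ⟨j, hj, hjt⟩ := ht
          exact absurd (mem_iUnion₂.2 ⟨⟨j, hj⟩, Finset.mem_attach _ _, by
            rw [hObd]; exact ⟨hzC, hjt.1, hjt.2⟩⟩) hzU
      refine measure_mono_null hsub ((measure_biUnion_null_iff G.countable_toSet).2 fun j _ => ?_)
      exact volume_graph_eq_zero (hξ j)
    · intro j _ j' _ hne
      have hne' : (j : Fin (l + 1)) ≠ j' := fun h => hne (Subtype.ext h)
      have : (Ob j).domain ∩ (Ob j').domain = ∅ := by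
        rw [hObd, hObd]
        ext z
        simp only [mem_inter_iff, mem_empty_iff_false, iff_false, not_and]
        intro hz hz'
        rw [mem_bandOver_iff] at hz hz'
        exact (Set.disjoint_left.1 (disjoint_bandFibre ξ (hmono _ hz.1) hne')) ⟨hz.2.1, hz.2.2⟩
          ⟨hz'.2.1, hz'.2.2⟩
      rw [this, measure_empty]
  -- Step 2: close the bands (null modification) and go down by Newton–Leibniz
  have hBb : ∀ j : {j // j ∈ B}, ∃ (Bd : IntegralRep (m + 1)) (b : IntegralRep m),
      Bd.domain = KZlog.band C (fun x => (bandLower ξ j x).toReal) (fun x => (bandUpper ξ j x).toReal) ∧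
      (Bd.integrand = fun _ => 1) ∧ b.domain = C ∧
      (b.integrand = fun x => (bandUpper ξ j x).toReal - (bandLower ξ j x).toReal) ∧
      of Bd - of b ∈ newtonLeibnizRel := fun j =>
    exists_band_sub_base_mem_newtonLeibnizRel hfin hC ξ hξ hmono (hinner j j.2).1 (hinner j j.2).2
      (hBsub j j.2)
  choose Bd b hBdd hBdi hbd hbi hNL using hBb
  have e2 : ∀ j : {j // j ∈ B}, of (Ob j) - of (Bd j) ∈ relations := by
    intro j
    have h0 := (hinner j j.2).1
    have hl := (hinner j j.2).2
    refine of_sub_of_mem_relations_of_null (Ob j) (Bd j) ?_ ?_ fun z _ => by rw [hObi, hBdi]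
    · rw [hObd, hBdd, show bandOver C ξ j \ KZlog.band C (fun x => (bandLower ξ j x).toReal)
          (fun x => (bandUpper ξ j x).toReal) = ∅ from sdiff_eq_empty.mpr fun z hz => ?_, measure_empty]
      rw [mem_bandOver_iff, bandLower_of_ne_zero ξ j h0, bandUpper_of_ne_last ξ j hl,
        EReal.coe_lt_coe_iff, EReal.coe_lt_coe_iff] at hz
      rw [KZlog.mem_band, bandLower_of_ne_zero ξ j h0, bandUpper_of_ne_last ξ j hl, EReal.toReal_coe,
        EReal.toReal_coe]
      exact ⟨hz.1, hz.2.1.le, hz.2.2.le⟩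
    · have hlosa : IsSemialgebraicFunOn ℚ C fun x => (bandLower ξ j x).toReal :=
        (hξ (Fin.pred j h0)).congr fun x _ => by rw [bandLower_of_ne_zero ξ j h0, EReal.toReal_coe]
      have hhisa : IsSemialgebraicFunOn ℚ C fun x => (bandUpper ξ j x).toReal :=
        (hξ (Fin.castPred j hl)).congr fun x _ => by rw [bandUpper_of_ne_last ξ j hl, EReal.toReal_coe]
      refine measure_mono_null (fun z hz => ?_)
        (measure_union_null (volume_graph_eq_zero hlosa) (volume_graph_eq_zero hhisa))
      rw [hBdd, hObd] at hz
      obtain ⟨hz, hz'⟩ := hz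
      rw [KZlog.mem_band] at hz
      obtain ⟨hzC, h1, h2⟩ := hz
      rcases h1.lt_or_eq with h1 | h1
      · rcases h2.lt_or_eq with h2 | h2
        · refine absurd (mem_bandOver_iff.2 ⟨hzC, ?_, ?_⟩) hz'
          · rw [bandLower_of_ne_zero ξ j h0, EReal.coe_lt_coe_iff]
            rwa [bandLower_of_ne_zero ξ j h0, EReal.toReal_coe] at h1
          · rw [bandUpper_of_ne_last ξ j hl, EReal.coe_lt_coe_iff]
            rwa [bandUpper_of_ne_last ξ j hl, EReal.toReal_coe] at h2
        · exact Or.inr ⟨hzC, h2⟩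
      · exact Or.inl ⟨hzC, h1.symm⟩
  -- Step 3: add up the widths: the fibre length `L` over `C`
  let bL : IntegralRep m :=
    { domain := C
      integrand := fun x => ∑ j ∈ B.attach, (b j).integrand x
      isSemialgebraic_domain := hC
      isSemialgebraicFunOn_integrand := isSemialgebraicFunOn_finset_sum B.attach hC fun j _ =>
        hbd j ▸ (b j).isSemialgebraicFunOn_integrand
      integrableOn := integrable_finsetSum B.attach fun j _ => hbd j ▸ (b j).integrableOn }
  have e3 : of bL - ∑ j ∈ B.attach, of (b j) ∈ relations :=
    of_sub_sum_integrand_mem_relations B.attach b bL (fun j _ => hbd j) fun x _ => rfl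
  have hL : ∀ x, bL.integrand x = ∑ j ∈ B, ((bandUpper ξ j x).toReal - (bandLower ξ j x).toReal) := by
    intro x
    show ∑ j ∈ B.attach, (b j).integrand x = _
    simp_rw [hbi]
    exact Finset.sum_attach B fun j => (bandUpper ξ j x).toReal - (bandLower ξ j x).toReal
  -- assembly
  have e2' : ∑ j ∈ B.attach, of (Ob j) - ∑ j ∈ B.attach, of (Bd j) ∈ relations :=
    sum_sub_sum_mem_relations _ _ _ fun j _ => e2 j
  have eNL : ∑ j ∈ B.attach, of (Bd j) - ∑ j ∈ B.attach, of (b j) ∈ relations :=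
    sum_sub_sum_mem_relations _ _ _ fun j _ => newtonLeibnizRel_subset_relations (hNL j)
  refine ⟨bL, rfl, hL, hinner, ?_⟩
  have : of r - of bL = (of r - ∑ j ∈ B.attach, of (Ob j)) +
      (∑ j ∈ B.attach, of (Ob j) - ∑ j ∈ B.attach, of (Bd j)) +
      (∑ j ∈ B.attach, of (Bd j) - ∑ j ∈ B.attach, of (b j)) -
      (of bL - ∑ j ∈ B.attach, of (b j)) := by abel
  rw [this]
  exact relations.sub_mem (relations.add_mem (relations.add_mem e1 e2') eNL) e3

/-! ## 2. A zero representation on the unit interval (used for the negligible cells) -/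

/-- The open unit interval of `ℝ¹` is `ℚ`-semialgebraic. -/
theorem isSemialgebraic_soloInformedOpenUnit :
    IsSemialgebraic ℚ {x : Fin 1 → ℝ | (0 : ℝ) < x 0 ∧ x 0 < 1} := by
  have h1 := isSemialgebraic_setOf_eval_lt (k := ℚ) (R := ℝ)
    (MvPolynomial.C 0 : MvPolynomial (Fin 1) ℚ) (MvPolynomial.X 0)
  have h2 := isSemialgebraic_setOf_eval_lt (k := ℚ) (R := ℝ)
    (MvPolynomial.X 0 : MvPolynomial (Fin 1) ℚ) (MvPolynomial.C 1)
  have hset : {x : Fin 1 → ℝ | (0 : ℝ) < x 0 ∧ x 0 < 1} =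
      {x | MvPolynomial.aeval x (MvPolynomial.C 0 : MvPolynomial (Fin 1) ℚ) <
          MvPolynomial.aeval x (MvPolynomial.X 0 : MvPolynomial (Fin 1) ℚ)} ∩
        {x | MvPolynomial.aeval x (MvPolynomial.X 0 : MvPolynomial (Fin 1) ℚ) <
          MvPolynomial.aeval x (MvPolynomial.C 1 : MvPolynomial (Fin 1) ℚ)} := by
    ext x; simp
  rw [hset]
  exact h1.inter h2

/-- The zero representation `[(0, 1), 0]` of dimension one. -/
def soloInformedZeroRep1 : IntegralRep 1 :=
  ⟨{x : Fin 1 → ℝ | (0 : ℝ) < x 0 ∧ x 0 < 1}, fun _ => 0, isSemialgebraic_soloInformedOpenUnit,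
    (isSemialgebraicFunOn_aeval isSemialgebraic_soloInformedOpenUnit 0).congr fun x _ => by simp,
    integrableOn_zero⟩

/-- `[(0, 1), 0]` is a relation. -/
theorem soloInformedZeroRep1_mem_relations : of soloInformedZeroRep1 ∈ relations :=
  of_mem_relations_of_eqOn_zero _ fun _ _ => rfl

/-! ## 3. The planar reduction -/

/-- **Planar volumes are sums of fibre-length integrals over algebraic intervals.** For `r = [K, 1]`
with `K ⊆ ℝ²` compact (`ℚ`-semialgebraic, integrand `1` on `K`), there are finitely many bounded open
intervals `(aᵢ, bᵢ) ⊆ ℝ` with algebraic end points and one-dimensional representations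
`ρᵢ = [(aᵢ, bᵢ), Lᵢ]` with `Lᵢ` continuous, non-negative and bounded on `(aᵢ, bᵢ)`, such that
`[K, 1] − Σᵢ [ρᵢ] ∈ KZ.relations`. [Kontsevich–Zagier 2001, §1.2 rules (1), (3);
Basu–Pollack–Roy 2006, Cor. 5.7] -/
theorem soloInformed_planarBands (r : IntegralRep 2) (hK : IsCompact r.domain)
    (hr1 : ∀ x ∈ r.domain, r.integrand x = 1) :
    ∃ (k : ℕ) (a b : Fin k → ℝ) (ρ : Fin k → IntegralRep 1),
      (∀ i, a i < b i) ∧ (∀ i, IsAlgebraic ℚ (a i)) ∧ (∀ i, IsAlgebraic ℚ (b i)) ∧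
      (∀ i, (ρ i).domain = {x | a i < x 0 ∧ x 0 < b i}) ∧
      (∀ i, ContinuousOn (ρ i).integrand {x | a i < x 0 ∧ x 0 < b i}) ∧
      (∀ i, ∃ M : ℝ, ∀ x ∈ (ρ i).domain, 0 ≤ (ρ i).integrand x ∧ (ρ i).integrand x ≤ M) ∧
      of r - ∑ i, of (ρ i) ∈ relations := by
  classical
  -- a coordinate bound for the compact domain
  obtain ⟨R, hR⟩ := isBounded_iff_forall_norm_le.mp hK.isBounded
  have hRi : ∀ z ∈ r.domain, ∀ i, |z i| ≤ R := fun z hz i => by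
    have h := norm_le_pi_norm z i
    rw [Real.norm_eq_abs] at h
    exact h.trans (hR z hz)
  have hS : IsSemialgebraic ℚ r.domain := r.isSemialgebraic_domain
  have hfin : volume r.domain ≠ ⊤ := volume_ne_top_of_integrand_one r hr1
  -- cylindrical decomposition of the line adapted to `K`
  obtain ⟨𝒮, l, ξ, hcd, hcont, hξ, hmono, hcells, hfib⟩ :=
    IsSemialgebraic.exists_cylindricalDecomposition.exists_fibre_eq
      (IsSemialgebraic.exists_cylindricalDecomposition_holds (k := ℚ)) hS
  have hpart := hcd.isPartition
  have h𝒮sa := hcd.isSemialgebraic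
  -- the cells of the line: points and intervals
  obtain ⟨-, -, 𝒮₀, h𝒮₀, l₀, ξ₀, -, hξ₀sa, hξ₀mono, hmem₀⟩ :=
    (isCylindricalDecomposition_succ (k := ℚ) (n := 0)).1 hcd
  have h𝒮₀' : 𝒮₀ = {univ} := (isCylindricalDecomposition_zero (k := ℚ)).1 h𝒮₀
  have huniv : (univ : Set (Fin 0 → ℝ)) ∈ 𝒮₀ := by rw [h𝒮₀']; exact Finset.mem_singleton_self _
  set x₀ : Fin 0 → ℝ := fun i => i.elim0 with hx₀
  have hinit : ∀ z : Fin 1 → ℝ, Fin.init z = x₀ := fun z => Subsingleton.elim _ _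
  -- the pieces of `r` over the cells
  let RC : {C // C ∈ 𝒮} → IntegralRep 2 := fun C =>
    r.restrict (r.domain ∩ {z | Fin.init z ∈ (C : Set (Fin 1 → ℝ))})
      (hS.inter (h𝒮sa C C.2).setOf_init_mem) inter_subset_left
  have e0 : of r - ∑ C ∈ 𝒮.attach, of (RC C) ∈ relations :=
    of_sub_sum_cyl_mem_relations r 𝒮 hpart RC (fun C => rfl) fun C x _ => rfl
  -- per cell
  have hcell : ∀ C : {C // C ∈ 𝒮}, ∃ (a b : ℝ) (ρ : IntegralRep 1), a < b ∧ IsAlgebraic ℚ a ∧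
      IsAlgebraic ℚ b ∧ ρ.domain = {x | a < x 0 ∧ x 0 < b} ∧
      ContinuousOn ρ.integrand {x | a < x 0 ∧ x 0 < b} ∧
      (∃ M : ℝ, ∀ x ∈ ρ.domain, 0 ≤ ρ.integrand x ∧ ρ.integrand x ≤ M) ∧
      of (RC C) - of ρ ∈ relations := by
    intro C
    -- negligible cells are replaced by the zero representation
    have hneg : of (RC C) ∈ relations → ∃ (a b : ℝ) (ρ : IntegralRep 1), a < b ∧ IsAlgebraic ℚ a ∧
        IsAlgebraic ℚ b ∧ ρ.domain = {x | a < x 0 ∧ x 0 < b} ∧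
        ContinuousOn ρ.integrand {x | a < x 0 ∧ x 0 < b} ∧
        (∃ M : ℝ, ∀ x ∈ ρ.domain, 0 ≤ ρ.integrand x ∧ ρ.integrand x ≤ M) ∧
        of (RC C) - of ρ ∈ relations := fun h =>
      ⟨0, 1, soloInformedZeroRep1, zero_lt_one, isAlgebraic_zero, isAlgebraic_one, rfl,
        continuousOn_const, ⟨0, fun x _ => ⟨le_rfl, le_rfl⟩⟩,
        relations.sub_mem h soloInformedZeroRep1_mem_relations⟩
    obtain ⟨G, B, -, hBsub, hfibC⟩ := hfib C C.2
    obtain ⟨S₀, hS₀, hshape⟩ := (hmem₀ C).1 C.2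
    have hS₀u : S₀ = univ := by rw [h𝒮₀'] at hS₀; exact Finset.mem_singleton.1 hS₀
    subst hS₀u
    rcases hshape with ⟨j, hCj⟩ | ⟨j, hCj⟩
    · -- a point: the cylinder over it is null
      apply hneg
      refine of_mem_relations_of_volume_eq_zero _ (measure_mono_null inter_subset_right ?_)
      refine KZ.volume_setOf_init_mem_eq_zero ?_
      rw [hCj]
      exact volume_graph_eq_zero (hξ₀sa univ huniv j)
    · -- an interval `C = (lower_j, upper_j)`
      have hCeq : (C : Set (Fin 1 → ℝ)) = {z | bandLower (ξ₀ univ) j x₀ < ((z 0 : ℝ) : EReal) ∧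
          ((z 0 : ℝ) : EReal) < bandUpper (ξ₀ univ) j x₀} := by
        rw [hCj]; ext z
        rw [mem_bandOver_iff, hinit z]
        simp only [mem_univ, true_and, mem_setOf_eq, Fin.last_zero]
      have hCopen : IsOpen (C : Set (Fin 1 → ℝ)) := by
        rw [hCeq]
        have hc : Continuous fun z : Fin 1 → ℝ => ((z 0 : ℝ) : EReal) :=
          continuous_coe_real_ereal.comp (continuous_apply 0)
        exact (isOpen_Ioo.preimage hc : IsOpen ((fun z : Fin 1 → ℝ => ((z 0 : ℝ) : EReal)) ⁻¹'
          Ioo (bandLower (ξ₀ univ) j x₀) (bandUpper (ξ₀ univ) j x₀)))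
      have hCne : (C : Set (Fin 1 → ℝ)).Nonempty := by
        rw [nonempty_iff_ne_empty]
        intro h
        exact hpart.1 (h ▸ C.2)
      have hC0 : volume (C : Set (Fin 1 → ℝ)) ≠ 0 := (hCopen.measure_pos volume hCne).ne'
      obtain ⟨bL, hbLd, hbLi, hinner, hrel⟩ := soloInformed_cell_base hS hfin (h𝒮sa C C.2) hC0
        (ξ C) (hξ C C.2) (hmono C C.2) G B hBsub (hcells C C.2).2 hfibC (RC C) rfl
        fun x hx => hr1 x hx.1
      by_cases hB : B = ∅
      · -- no band of `K` over `C`: the fibre length vanishes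
        apply hneg
        have hbL0 : of bL ∈ relations :=
          of_mem_relations_of_eqOn_zero bL fun x _ => by rw [hbLi, hB]; simp
        have : of (RC C) = (of (RC C) - of bL) + of bL := by abel
        rw [this]
        exact relations.add_mem hrel hbL0
      · -- some band of `K` lies over `C`: `C` is a bounded inner interval
        obtain ⟨j₁, hj₁⟩ := Finset.nonempty_iff_ne_empty.2 hB
        have hCbdd : ∀ x ∈ (C : Set (Fin 1 → ℝ)), |x 0| ≤ R := by
          intro x hx
          have h0 := (hinner j₁ hj₁).1
          have hl := (hinner j₁ hj₁).2
          have hlt := toReal_bandLower_lt_toReal_bandUpper (ξ C) (hmono C C.2 x hx) h0 hl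
          set t : ℝ := ((bandLower (ξ C) j₁ x).toReal + (bandUpper (ξ C) j₁ x).toReal) / 2 with ht
          have htmem : (Fin.snoc x t : Fin 2 → ℝ) ∈ bandOver C (ξ C) j₁ := by
            refine snoc_mem_bandOver_iff.2 ⟨hx, ?_, ?_⟩
            · rw [bandLower_of_ne_zero (ξ C) j₁ h0, EReal.coe_lt_coe_iff]
              rw [bandLower_of_ne_zero (ξ C) j₁ h0, EReal.toReal_coe] at hlt ht
              rw [bandUpper_of_ne_last (ξ C) j₁ hl, EReal.toReal_coe] at hlt ht
              rw [ht]; linarith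
            · rw [bandUpper_of_ne_last (ξ C) j₁ hl, EReal.coe_lt_coe_iff]
              rw [bandLower_of_ne_zero (ξ C) j₁ h0, EReal.toReal_coe] at hlt ht
              rw [bandUpper_of_ne_last (ξ C) j₁ hl, EReal.toReal_coe] at hlt ht
              rw [ht]; linarith
          have hz := hRi _ (hBsub j₁ hj₁ htmem) (Fin.castSucc 0)
          rwa [Fin.snoc_castSucc] at hz
        have hR0 : 0 ≤ R := by
          obtain ⟨x, hx⟩ := hCne
          exact (abs_nonneg _).trans (hCbdd x hx)
        -- the interval is inner
        have hj0 : j ≠ 0 := by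
          intro hj
          subst hj
          obtain ⟨u, hu⟩ := exists_coe_lt_bandUpper (ξ₀ univ) 0 x₀
          have hzC : (fun _ => min u (-(R + 1)) : Fin 1 → ℝ) ∈ (C : Set (Fin 1 → ℝ)) := by
            rw [hCeq]
            refine ⟨by rw [bandLower_zero]; exact EReal.bot_lt_coe _, lt_of_le_of_lt ?_ hu⟩
            exact EReal.coe_le_coe_iff.2 (min_le_left _ _)
          have h := hCbdd _ hzC
          have h' : min u (-(R + 1)) ≤ -(R + 1) := min_le_right _ _
          rw [abs_le] at h
          linarith [h.1]
        have hjl : j ≠ Fin.last (l₀ univ) := by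
          intro hj
          subst hj
          obtain ⟨u, hu⟩ := exists_bandLower_lt_coe (ξ₀ univ) (Fin.last (l₀ univ)) x₀
          have hzC : (fun _ => max u (R + 1) : Fin 1 → ℝ) ∈ (C : Set (Fin 1 → ℝ)) := by
            rw [hCeq]
            refine ⟨lt_of_lt_of_le hu ?_, by rw [bandUpper_last]; exact EReal.coe_lt_top _⟩
            exact EReal.coe_le_coe_iff.2 (le_max_left _ _)
          have h := hCbdd _ hzC
          have h' : R + 1 ≤ max u (R + 1) := le_max_right _ _
          rw [abs_le] at h
          linarith [h.2]
        -- its end points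
        set c₁ : ℝ := ξ₀ univ (j.pred hj0) x₀ with hc₁
        set c₂ : ℝ := ξ₀ univ (j.castPred hjl) x₀ with hc₂
        have hCeq' : (C : Set (Fin 1 → ℝ)) = {x | c₁ < x 0 ∧ x 0 < c₂} := by
          rw [hCeq]; ext z
          rw [mem_setOf_eq, mem_setOf_eq, bandLower_of_ne_zero (ξ₀ univ) j hj0,
            bandUpper_of_ne_last (ξ₀ univ) j hjl, EReal.coe_lt_coe_iff, EReal.coe_lt_coe_iff]
        have hc12 : c₁ < c₂ := hξ₀mono univ huniv x₀ (mem_univ _) (Fin.pred_lt_castPred hj0 hjl)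
        have halg : ∀ i, IsAlgebraic ℚ (ξ₀ univ i x₀) := fun i =>
          (hξ₀sa univ huniv i).isAlgebraic_apply (mem_univ x₀) fun i => i.elim0
        -- continuity and bounds of the fibre length
        have hLfun : bL.integrand = fun x => ∑ j ∈ B, ((bandUpper (ξ C) j x).toReal -
            (bandLower (ξ C) j x).toReal) := funext hbLi
        have hLcont : ContinuousOn bL.integrand (C : Set (Fin 1 → ℝ)) := by
          rw [hLfun]
          refine continuousOn_finsetSum _ fun j hj => ContinuousOn.sub ?_ ?_
          · exact (hcont C C.2 (j.castPred (hinner j hj).2)).congr fun x _ => by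
              rw [bandUpper_of_ne_last (ξ C) j (hinner j hj).2, EReal.toReal_coe]
          · exact (hcont C C.2 (j.pred (hinner j hj).1)).congr fun x _ => by
              rw [bandLower_of_ne_zero (ξ C) j (hinner j hj).1, EReal.toReal_coe]
        have hLbd : ∀ x ∈ bL.domain, 0 ≤ bL.integrand x ∧ bL.integrand x ≤ 2 * R := by
          intro x hx
          rw [hbLd] at hx
          have hL0 : 0 ≤ bL.integrand x := by
            rw [hbLi]
            exact Finset.sum_nonneg fun j hj => (sub_pos.2 (toReal_bandLower_lt_toReal_bandUpper
              (ξ C) (hmono C C.2 x hx) (hinner j hj).1 (hinner j hj).2)).le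
          refine ⟨hL0, ?_⟩
          have hvol := volume_fibre_eq_ofReal_sum (S := r.domain) (ξ C) (hmono C C.2 x hx) G B
            hinner (hfibC x hx)
          have hsub : FibreLength.fibre r.domain x ⊆ Icc (-R) R := by
            intro t ht
            have h := hRi _ ht (Fin.last 1)
            rw [Fin.snoc_last] at h
            exact abs_le.1 h
          have hle := (measure_mono hsub).trans_eq (Real.volume_Icc (a := -R) (b := R))
          rw [hvol, ← hbLi, ENNReal.ofReal_le_ofReal_iff (by linarith)] at hle
          linarith
        refine ⟨c₁, c₂, bL, hc12, halg _, halg _, by rw [hbLd, hCeq'], by rw [← hCeq']; exact hLcont,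
          ⟨2 * R, hLbd⟩, hrel⟩
  choose a b ρ hab ha hb hρd hρc hρM hρrel using hcell
  -- reindex by `Fin k`
  let e := (Fintype.equivFin {C // C ∈ 𝒮}).symm
  refine ⟨_, a ∘ e, b ∘ e, ρ ∘ e, fun i => hab _, fun i => ha _, fun i => hb _, fun i => hρd _,
    fun i => hρc _, fun i => hρM _, ?_⟩
  have hsum : ∑ i, of ((ρ ∘ e) i) = ∑ C ∈ 𝒮.attach, of (ρ C) := by
    rw [← Finset.univ_eq_attach]
    exact e.sum_comp (fun C => of (ρ C))
  rw [hsum]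
  have e1 : ∑ C ∈ 𝒮.attach, of (RC C) - ∑ C ∈ 𝒮.attach, of (ρ C) ∈ relations :=
    sum_sub_sum_mem_relations _ _ _ fun C _ => hρrel C
  have : of r - ∑ C ∈ 𝒮.attach, of (ρ C) = (of r - ∑ C ∈ 𝒮.attach, of (RC C)) +
      (∑ C ∈ 𝒮.attach, of (RC C) - ∑ C ∈ 𝒮.attach, of (ρ C)) := by abel
  rw [this]
  exact relations.add_mem e0 e1

end Summit.KontsevichZagierPeriods.KontsevichZagierPeriods.Theorems
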